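import Literature.NumberTheory.EllipticCurves.EmertonPollackWeston2006.HidaFamilyTransferProjections
import Literature.NumberTheory.EllipticCurves.Rank1Residual.Typed.MultiplicativeRankZero
import Literature.NumberTheory.EllipticCurves.Rank1Residual.Typed.X11
import HarnessLib

/-!
# X11 ∧ `¬ram(p)`, rank `0`, `p ≥ 5`: the LAST class-level residue of X11 is reached by a PUBLISHED mechanism — Hida-family transfer from a congruent partner (cell `b2b-bsdres`)

HONEST FRAMING (run/shared/lean/b2b/bsd-rank1-residual/, verbatim): the goal of the cell is to
DELETE the COMBINATION-SHAPED residual classes for ALL analytic-rank `≤ 1` elliptic curves over `ℚ`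
— "full BSD formula for every rank `≤ 1` curve in class C" assembled STRICTLY from published
theorems — so that the rank-`≤ 1` remainder becomes exactly the CONSTRUCTION-SHAPED classes, which
are TYPED (missing-input `Prop`s), NOT attempted. This is not "finishing BSD".

Theorems only (no definition, no new named fact; prover x11a gen 8). After gens 1–7 the only
CLASS-LEVEL typed input left on X11 at `p ≥ 5` is the rank-`0` one, `X11RankZero.MissingInputAt W p`
(`Typed/X11.lean`): on `mult(p) ∧ irr(p) ∧ ¬ram(p) ∧ r = 0` with `ρ̄_{E,p}` surjective the UPPER
bound is Wuthrich 2014 Prop. 21 and the LOWER bound `ord_p #Ш_an ≤ ord_p #Ш` — the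
Eisenstein-congruence direction of the main conjecture at `p ‖ N`, printed only under (ram) — was
"reached by nothing, published or announced" (REFEREE C3; census `N < 2·10⁴`: 10580l1@5, 17640l1@5,
`#Ш_an = 25`). This file records the published mechanism that DOES reach it, and its exact per-pair
inputs: Emerton–Pollack–Weston, Invent. Math. 163 (2006) Cor. 5.1.4 / Thm. 5.1.3 — the main-conjecture
identity with `μ = 0` passes along the Hida family `H(ρ̄)`, in particular from ANY elliptic curve
`E₁` with `E₁[p] ≅ E[p]` at which it is known (named facts
`EmertonPollackWeston2006.cor514_transfer_of_goodOrdinary` / `cor514_transfer_of_multiplicative`,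
p182930) — composed with the rank-`0` glue at a multiplicative prime
(`bsdp_of_multCharIdeal_{split,nonsplit}_rankZero`, p182962: the EQUALITY of ideals + Stein–Wuthrich
Thm. 6.1 + interpolation / Greenberg–Stevens give `BSD(E,p)` with NO numerical certificate and with
`p ∣ #Ш_an` allowed). So, for `(E, p)` in X11 with `ord_{s=1} L(E,s) = 0` (surjective image NOT
needed — irreducible suffices):
  `BSD(E,p)` ⇐ [PUBLISHED: EPW 2006, SW 2013 Thm. 6.1 + §4.2 existence, MTT/Greenberg–Stevens, BDGP,
  GZK, modularity] + [per-pair, CONSTRUCTION-shaped: a partner `E₁` (good ordinary or multiplicative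
  at `p`) with a `Γ_ℚ`-isomorphism `E₁[p] ≃ E[p]` AND the integral main-conjecture identity with
  `μ = 0` for `(E₁, p)` (`GoodOrdinaryCharIdealMuZero W₁ p` / `MultiplicativeCharIdealMuZero W₁ p`
  — e.g. Skinner 2016 Thm. A for a (ram) partner + the certificate "`μ^an = 0`",
  `multiplicativeCharIdealMuZero_of_thmA`; or the Rubin ∘ Greenberg–Vatsal CM route; or
  Burungale–Castella–Skinner 2025 Thm. 1.1.2(b) + "`μ^an = 0`" for a good-ordinary partner)].

**What this does NOT reach (the precise remainder; `b2b-bsdres-x11a/REPORT-g8.md` §2, wording per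
REFEREE R32.4 and `REPORT-g9.md` §5).** "`ρ̄` ramified at `q`" is a property of `ρ̄ = E[p]`, shared by
every member of `H(ρ̄)`; "`q ‖ N`" (multiplicative / Steinberg at `q`) is a property of the member.
For ELLIPTIC-CURVE members and `p ≥ 5` the two together — Skinner's (iii) / Skinner–Urban's (mult) =
(ram) — are nevertheless a `ρ̄`-invariant (a ramified `q ‖ N_{E₁}` forces unipotent inertia of order `p`
on `ρ̄`, impossible for good, potentially good (`#Φ_q ∣ 24`) or additive potentially multiplicative
reduction of `E` at `q`; so `q ‖ N_E` too): for a `¬ram` curve NO congruent elliptic curve satisfies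
(ram). A partner with a KNOWN identity therefore
needs a (ram)-free source: Burungale–Castella–Skinner 2025 at a GOOD ordinary `p` (weight two, level
prime to `p`) — available inside `H(ρ̄)` iff `ρ̄` is finite at `p` ("peu ramifié": `p ∣ v_p(Δ_min)`,
Ribet 1990 / Edixhoven), through the level-lowered newform `g` of level `N/p`, a `GL₂`-type form
whose Selmer/`L_p` vocabulary the tree does not have (so only an ELLIPTIC-CURVE partner `E₁` of level
prime to `p` is consumable here); for a "très ramifié" `ρ̄` (`p ∤ v_p(Δ_min)`: BOTH open census pairs,
`v₅(Δ_min) = 1` resp. `7`) every weight-two member of `H(ρ̄)` has `p` in its level and no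
(ram)-free source is in print. The typed input `X11RankZero.MissingInputAt` stays the class-level
residue; this file only makes "reached by nothing" precise: reached by EPW transfer exactly when a
partner with a known identity exists. (The two census pairs have instead RANK-TWO partners of the
same conductor congruent mod `5` — 10580o1, 17640m1 —, the Cremona–Mazur visibility situation:
certificate route `X11RankZero.bsdp_of_casselsTate_of_dvd`, REPORT-g8.md §3.)

Contents: `X11RankZero.bsdp_of_multCharIdealMuZero_{nonsplit,split}` (X11, `r = 0`, the EPW/Skinner
shape for `(E,p)` ⇒ `BSD(E,p)`), `X11RankZero.missingInputAt_of_multCharIdealMuZero_{nonsplit,split}`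
(the typed input DISCHARGED by the shape), `X11RankZero.bsdp_of_transfer_goodOrdinary_{nonsplit,split}`
and `X11RankZero.bsdp_of_transfer_multiplicative_{nonsplit,split}` (partner-explicit forms through the
two named facts). Rank `1` is not treated here: on X11 ∧ `r = 1` every census pair has surjective
`ρ̄` and is already "F35 + certificate" (`Typed/PAdicCertificateMultiplicativeExists.lean`); the
transfer would only replace F35's divisibility by the full identity.

References: Emerton–Pollack–Weston 2006 Cor. 5.1.4, Thm. 5.1.3, Ex. 5.3.1 [EmertonPollackWeston2006];
Skinner 2016 Thm. A/C, §3.2–3.3 [Skinner2016PacificMC]; Stein–Wuthrich 2013 Thm. 6.1, §4.2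
[SteinWuthrich2013]; Greenberg–Stevens 1993 [GreenbergStevens1993]; Wuthrich 2014 Prop. 21
[Wuthrich2014]; Miller 2011 Def. 1.1 [Miller2011LMS]; Burungale–Castella–Skinner 2025 Thm. 1.1.2
[BurungaleCastellaSkinner2025]; Ribet 1990 (level lowering); Cremona–Mazur 2000 (visibility).
-/

set_option autoImplicit false

noncomputable section

open scoped Classical MatrixGroups ModularForm

open CongruenceSubgroup WeierstrassCurve Literature.NumberTheory.EllipticCurves
  Literature.NumberTheory.EllipticCurves.ModularForms
  Literature.NumberTheory.EllipticCurves.Rank1Residual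
  Literature.NumberTheory.EllipticCurves.Skinner2016
  Literature.NumberTheory.EllipticCurves.Wuthrich2014
  Literature.NumberTheory.EllipticCurves.SteinWuthrich2013
  Literature.NumberTheory.EllipticCurves.EmertonPollackWeston2006

namespace Literature.NumberTheory.EllipticCurves.Rank1Residual.Typed

variable (W : WeierstrassCurve ℚ) [W.IsElliptic] [W.IsGloballyMinimal] (p : ℕ) [Fact p.Prime]

/-! ### X11, rank `0`: `BSD(E,p)` from the multiplicative main-conjecture shape for `(E, p)` itself -/

/-- **X11 ∧ `r = 0`, NON-split `p ≠ 2`: `BSD(E,p)` from the integral main-conjecture identity with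
`μ = 0` for `(E, p)` (`hMC : MultiplicativeCharIdealMuZero W p`, the conclusion shape of the
Emerton–Pollack–Weston transfer and of Skinner's Thm. A) — no numerical certificate, `p ∣ #Ш_an`
allowed, surjectivity of `ρ̄` not needed.** `ClassX11 W p` supplies multiplicative reduction; the rest
is `bsdp_of_multCharIdeal_nonsplit_rankZero` (Stein–Wuthrich Thm. 6.1 `hJ`, height existence `hH`,
GZK, modularity). Data: Tate parameter, cyclotomic data, newform, dual datum, period ratio, THE
non-split `p`-adic `L`-function. Per pair (the identity `hMC` is the input); NOT a deletion of X11.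
[cite: EmertonPollackWeston2006, Cor. 5.1.4 (arXiv:math/0404484 p. 30)]
[cite: SteinWuthrich2013, Thm. 6.1 (p. 20) and §4.2] [cite: Miller2011LMS, Def. 1.1 and §1] -/
theorem X11RankZero.bsdp_of_multCharIdealMuZero_nonsplit (hJ : thm61_nonsplitMultiplicative)
    (hH : exists_isMultCanonical) (hGZK : rank_eq_analyticRank_of_analyticRank_le_one)
    (hmod : hasEntireLFunction_rat)
    {κ : ZpExtension ℚ p} {γ : Field.absoluteGaloisGroup ℚ} {N : ℕ} [NeZero N]
    {f : CuspForm (Gamma0 N) 2} (hp : p ≠ 2) (hr : W.analyticRank = 0) (hX : ClassX11 W p)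
    (hns : ¬ W.HasSplitMultiplicativeReductionAtPrime p) (hMC : MultiplicativeCharIdealMuZero W p)
    {q : ℚ_[p]} (hq0 : q ≠ 0) (hq1 : ‖q‖ < 1) (hqj : tateJ q = (W.j : ℚ_[p]))
    (hκ : κ.IsCyclotomic) (hγ : κ.IsTopGenerator γ) (hγ' : IsCyclotomicVariable p γ)
    (hf : IsNewformOf W f) (D : W.SelmerDualData κ γ) (ϖ : ℚ) (hϖ0 : ϖ ≠ 0)
    (hϖ : (ϖ : ℝ) * W.realPeriodRat = plusPeriod f)
    (L : PowerSeries ℚ_[p]) (hL : IsMultPAdicLFunctionOf f p (-1) L) : BSDp W p := by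
  refine bsdp_of_multCharIdeal_nonsplit_rankZero hJ hH hGZK hmod W p hp hr hX.mult hns hq0 hq1 hqj hκ
    hγ hγ' hf D ϖ hϖ0 hϖ L hL ?_
  obtain ⟨fE, w, hchar, -, hw⟩ :=
    hMC.exists_charIdeal_eq_unit_nonsplit hκ hγ hγ' hf D ϖ hϖ0 hϖ hns L hL
  exact ⟨hMC.isTorsion hκ hγ hγ' hf D ϖ hϖ0 hϖ, fE, w, hchar, hw⟩

/-- **X11 ∧ `r = 0`, SPLIT `p ≠ 2`: `BSD(E,p)` from the integral main-conjecture identity with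
`μ = 0` for `(E, p)`** — `bsdp_of_multCharIdeal_split_rankZero` (Stein–Wuthrich Thm. 6.1 `hJ`, height
existence `hH`, Greenberg–Stevens `hGS`, `𝓛_p ≠ 0` `h𝓛`, GZK, modularity). Per pair; NOT a deletion.
[cite: EmertonPollackWeston2006, Cor. 5.1.4 (arXiv:math/0404484 p. 30)]
[cite: SteinWuthrich2013, Thm. 6.1 (p. 20) and §4.2] [cite: GreenbergStevens1993, Thm. (trivial zero)]
[cite: Miller2011LMS, Def. 1.1 and §1] -/
theorem X11RankZero.bsdp_of_multCharIdealMuZero_split (hJ : thm61_splitMultiplicative)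
    (hH : exists_isSplitMultCanonical) (hGZK : rank_eq_analyticRank_of_analyticRank_le_one)
    (hmod : hasEntireLFunction_rat)
    (hGS : greenberg_stevens (W := W) (p := p)) (h𝓛 : LInvariant_ne_zero (W := W) (p := p))
    {κ : ZpExtension ℚ p} {γ : Field.absoluteGaloisGroup ℚ} {N : ℕ} [NeZero N]
    {f : CuspForm (Gamma0 N) 2} (hp : p ≠ 2) (hr : W.analyticRank = 0) (_hX : ClassX11 W p)
    (hMC : MultiplicativeCharIdealMuZero W p) (Dq : TateParameterData W p)
    (hκ : κ.IsCyclotomic) (hγ : κ.IsTopGenerator γ) (hγ' : IsCyclotomicVariable p γ)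
    (hf : IsNewformOf W f) (D : W.SelmerDualData κ γ) (ϖ : ℚ) (hϖ0 : ϖ ≠ 0)
    (hϖ : (ϖ : ℝ) * W.realPeriodRat = plusPeriod f)
    (L : PowerSeries ℚ_[p]) (hL : IsSplitMultPAdicLFunctionOf f p L) : BSDp W p := by
  refine bsdp_of_multCharIdeal_split_rankZero hJ hH hGZK hmod W p hGS h𝓛 hp hr Dq hκ hγ hγ' hf D ϖ
    hϖ0 hϖ L hL ?_
  obtain ⟨fE, w, hchar, -, hw⟩ :=
    hMC.exists_charIdeal_eq_unit_split hκ hγ hγ' hf D ϖ hϖ0 hϖ Dq.split L hL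
  exact ⟨hMC.isTorsion hκ hγ hγ' hf D ϖ hϖ0 hϖ, fE, w, hchar, hw⟩

/-! ### The typed rank-zero input of `Typed/X11.lean` is DISCHARGED by the shape -/

/-- **X11 ∧ `r = 0`, non-split `p ≠ 2`: the typed missing input `X11RankZero.MissingInputAt W p`
HOLDS as soon as the multiplicative main-conjecture shape holds for `(E, p)`** (from `BSD(E,p)`,
`missingPPartAt_of_bsdp`, `X11RankZero.missingInputAt_of_missingPPartAt`). Bookkeeping: this is the
sense in which the LAST class-level residue of X11 at `p ≥ 5` is "reached" by the Hida-family
transfer. [cite: EmertonPollackWeston2006, Cor. 5.1.4 (arXiv:math/0404484 p. 30)]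
[cite: Miller2011LMS, Def. 1.1] -/
theorem X11RankZero.missingInputAt_of_multCharIdealMuZero_nonsplit (hJ : thm61_nonsplitMultiplicative)
    (hH : exists_isMultCanonical) (hGZK : rank_eq_analyticRank_of_analyticRank_le_one)
    (hmod : hasEntireLFunction_rat)
    {κ : ZpExtension ℚ p} {γ : Field.absoluteGaloisGroup ℚ} {N : ℕ} [NeZero N]
    {f : CuspForm (Gamma0 N) 2} (hp : p ≠ 2) (hr : W.analyticRank = 0) (hX : ClassX11 W p)
    (hns : ¬ W.HasSplitMultiplicativeReductionAtPrime p) (hMC : MultiplicativeCharIdealMuZero W p)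
    {q : ℚ_[p]} (hq0 : q ≠ 0) (hq1 : ‖q‖ < 1) (hqj : tateJ q = (W.j : ℚ_[p]))
    (hκ : κ.IsCyclotomic) (hγ : κ.IsTopGenerator γ) (hγ' : IsCyclotomicVariable p γ)
    (hf : IsNewformOf W f) (D : W.SelmerDualData κ γ) (ϖ : ℚ) (hϖ0 : ϖ ≠ 0)
    (hϖ : (ϖ : ℝ) * W.realPeriodRat = plusPeriod f)
    (L : PowerSeries ℚ_[p]) (hL : IsMultPAdicLFunctionOf f p (-1) L) :
    X11RankZero.MissingInputAt W p := by
  haveI : Finite W.sha := (hGZK W (by omega)).2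
  exact X11RankZero.missingInputAt_of_missingPPartAt
    (missingPPartAt_of_bsdp W p
      (X11RankZero.bsdp_of_multCharIdealMuZero_nonsplit W p hJ hH hGZK hmod hp hr hX hns hMC hq0 hq1 hqj
        hκ hγ hγ' hf D ϖ hϖ0 hϖ L hL))

/-- **X11 ∧ `r = 0`, split `p ≠ 2`: the typed missing input HOLDS given the shape** (as above).
[cite: EmertonPollackWeston2006, Cor. 5.1.4 (arXiv:math/0404484 p. 30)] [cite: Miller2011LMS, Def. 1.1] -/
theorem X11RankZero.missingInputAt_of_multCharIdealMuZero_split (hJ : thm61_splitMultiplicative)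
    (hH : exists_isSplitMultCanonical) (hGZK : rank_eq_analyticRank_of_analyticRank_le_one)
    (hmod : hasEntireLFunction_rat)
    (hGS : greenberg_stevens (W := W) (p := p)) (h𝓛 : LInvariant_ne_zero (W := W) (p := p))
    {κ : ZpExtension ℚ p} {γ : Field.absoluteGaloisGroup ℚ} {N : ℕ} [NeZero N]
    {f : CuspForm (Gamma0 N) 2} (hp : p ≠ 2) (hr : W.analyticRank = 0) (hX : ClassX11 W p)
    (hMC : MultiplicativeCharIdealMuZero W p) (Dq : TateParameterData W p)
    (hκ : κ.IsCyclotomic) (hγ : κ.IsTopGenerator γ) (hγ' : IsCyclotomicVariable p γ)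
    (hf : IsNewformOf W f) (D : W.SelmerDualData κ γ) (ϖ : ℚ) (hϖ0 : ϖ ≠ 0)
    (hϖ : (ϖ : ℝ) * W.realPeriodRat = plusPeriod f)
    (L : PowerSeries ℚ_[p]) (hL : IsSplitMultPAdicLFunctionOf f p L) :
    X11RankZero.MissingInputAt W p := by
  haveI : Finite W.sha := (hGZK W (by omega)).2
  exact X11RankZero.missingInputAt_of_missingPPartAt
    (missingPPartAt_of_bsdp W p
      (X11RankZero.bsdp_of_multCharIdealMuZero_split W p hJ hH hGZK hmod hGS h𝓛 hp hr hX hMC Dq hκ hγ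
        hγ' hf D ϖ hϖ0 hϖ L hL))

/-! ### Partner-explicit forms (the two named facts of Emerton–Pollack–Weston) -/

/-- **X11 ∧ `r = 0` (hence `¬ram(p)` at `p ≥ 5`), non-split `p ≥ 5`, GOOD-ORDINARY partner:
`BSD(E,p)` from PUBLISHED facts plus the per-pair inputs [a globally minimal `E₁` good ordinary at
`p`, a `Γ_ℚ`-isomorphism `E₁[p] ≃ E[p]`, `E₁[p]` irreducible, and the integral main-conjecture
identity with `μ = 0` for `(E₁, p)` (`h₁`)].** Emerton–Pollack–Weston Cor. 5.1.4 (`hEPW`) moves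
`h₁` to `(E, p)`; then `X11RankZero.bsdp_of_multCharIdealMuZero_nonsplit`. The partner exists only
if `E[p]` is finite at `p` (`p ∣ v_p(Δ_min)`); nothing is closed by this theorem until a partner and
`h₁` are certified (lane). [cite: EmertonPollackWeston2006, Cor. 5.1.4 and Thm. 5.1.3 (arXiv p. 30)]
[cite: SteinWuthrich2013, Thm. 6.1 (p. 20)] [cite: Miller2011LMS, Def. 1.1 and §1] -/
theorem X11RankZero.bsdp_of_transfer_goodOrdinary_nonsplit (hEPW : cor514_transfer_of_goodOrdinary)
    (hJ : thm61_nonsplitMultiplicative) (hH : exists_isMultCanonical)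
    (hGZK : rank_eq_analyticRank_of_analyticRank_le_one) (hmod : hasEntireLFunction_rat)
    (W₁ : WeierstrassCurve ℚ) [W₁.IsElliptic] [W₁.IsGloballyMinimal]
    {κ : ZpExtension ℚ p} {γ : Field.absoluteGaloisGroup ℚ} {N : ℕ} [NeZero N]
    {f : CuspForm (Gamma0 N) 2} (hp : 5 ≤ p) (hr : W.analyticRank = 0) (hX : ClassX11 W p)
    (hns : ¬ W.HasSplitMultiplicativeReductionAtPrime p)
    (hgood₁ : W₁.HasGoodReductionAtPrime p) (hord₁ : ¬ (p : ℤ) ∣ W₁.frobeniusTrace p)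
    (hiso : ∃ e : geomTorsion W₁ (p : ℤ) ≃+ geomTorsion W (p : ℤ),
      ∀ (σ : Field.absoluteGaloisGroup ℚ) (P : geomTorsion W₁ (p : ℤ)), e (σ • P) = σ • e P)
    (hirr₁ : W₁.HasIrreducibleModPGaloisRep p) (h₁ : GoodOrdinaryCharIdealMuZero W₁ p)
    {q : ℚ_[p]} (hq0 : q ≠ 0) (hq1 : ‖q‖ < 1) (hqj : tateJ q = (W.j : ℚ_[p]))
    (hκ : κ.IsCyclotomic) (hγ : κ.IsTopGenerator γ) (hγ' : IsCyclotomicVariable p γ)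
    (hf : IsNewformOf W f) (D : W.SelmerDualData κ γ) (ϖ : ℚ) (hϖ0 : ϖ ≠ 0)
    (hϖ : (ϖ : ℝ) * W.realPeriodRat = plusPeriod f)
    (L : PowerSeries ℚ_[p]) (hL : IsMultPAdicLFunctionOf f p (-1) L) : BSDp W p :=
  X11RankZero.bsdp_of_multCharIdealMuZero_nonsplit W p hJ hH hGZK hmod (by omega) hr hX hns
    (hEPW W₁ W p hp hgood₁ hord₁ hX.mult hiso hirr₁ h₁) hq0 hq1 hqj hκ hγ hγ' hf D ϖ hϖ0 hϖ L hL

/-- **X11 ∧ `r = 0`, split `p ≥ 5`, GOOD-ORDINARY partner**: as the non-split case, through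
`X11RankZero.bsdp_of_multCharIdealMuZero_split` (Greenberg–Stevens, `𝓛_p ≠ 0`).
[cite: EmertonPollackWeston2006, Cor. 5.1.4 and Thm. 5.1.3 (arXiv p. 30)]
[cite: SteinWuthrich2013, Thm. 6.1 (p. 20)] [cite: GreenbergStevens1993, Thm. (trivial zero)] -/
theorem X11RankZero.bsdp_of_transfer_goodOrdinary_split (hEPW : cor514_transfer_of_goodOrdinary)
    (hJ : thm61_splitMultiplicative) (hH : exists_isSplitMultCanonical)
    (hGZK : rank_eq_analyticRank_of_analyticRank_le_one) (hmod : hasEntireLFunction_rat)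
    (hGS : greenberg_stevens (W := W) (p := p)) (h𝓛 : LInvariant_ne_zero (W := W) (p := p))
    (W₁ : WeierstrassCurve ℚ) [W₁.IsElliptic] [W₁.IsGloballyMinimal]
    {κ : ZpExtension ℚ p} {γ : Field.absoluteGaloisGroup ℚ} {N : ℕ} [NeZero N]
    {f : CuspForm (Gamma0 N) 2} (hp : 5 ≤ p) (hr : W.analyticRank = 0) (hX : ClassX11 W p)
    (hgood₁ : W₁.HasGoodReductionAtPrime p) (hord₁ : ¬ (p : ℤ) ∣ W₁.frobeniusTrace p)
    (hiso : ∃ e : geomTorsion W₁ (p : ℤ) ≃+ geomTorsion W (p : ℤ),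
      ∀ (σ : Field.absoluteGaloisGroup ℚ) (P : geomTorsion W₁ (p : ℤ)), e (σ • P) = σ • e P)
    (hirr₁ : W₁.HasIrreducibleModPGaloisRep p) (h₁ : GoodOrdinaryCharIdealMuZero W₁ p)
    (Dq : TateParameterData W p)
    (hκ : κ.IsCyclotomic) (hγ : κ.IsTopGenerator γ) (hγ' : IsCyclotomicVariable p γ)
    (hf : IsNewformOf W f) (D : W.SelmerDualData κ γ) (ϖ : ℚ) (hϖ0 : ϖ ≠ 0)
    (hϖ : (ϖ : ℝ) * W.realPeriodRat = plusPeriod f)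
    (L : PowerSeries ℚ_[p]) (hL : IsSplitMultPAdicLFunctionOf f p L) : BSDp W p :=
  X11RankZero.bsdp_of_multCharIdealMuZero_split W p hJ hH hGZK hmod hGS h𝓛 (by omega) hr hX
    (hEPW W₁ W p hp hgood₁ hord₁ hX.mult hiso hirr₁ h₁) Dq hκ hγ hγ' hf D ϖ hϖ0 hϖ L hL

/-- **X11 ∧ `r = 0`, non-split `p ≥ 5`, MULTIPLICATIVE partner** (`E₁` multiplicative at `p` with
the multiplicative shape `h₁ : MultiplicativeCharIdealMuZero W₁ p` — e.g. a (ram) curve through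
Skinner's Thm. A and the certificate "`μ^an = 0`", `multiplicativeCharIdealMuZero_of_thmA`; NOTE
(R32.4 wording): "`ρ̄` ramified at `q`" is a `ρ̄`-property and "`q ‖ N_{E₁}`" a property of the partner,
but for elliptic curves at `p ≥ 5` (ram) as a whole is a `ρ̄`-invariant, so a (ram) partner of a `¬ram`
curve does not exist: this form serves a partner whose identity is known otherwise). [cite: EmertonPollackWeston2006, Cor. 5.1.4 and Thm. 5.1.3 (arXiv p. 30)]
[cite: SteinWuthrich2013, Thm. 6.1 (p. 20)] [cite: Miller2011LMS, Def. 1.1 and §1] -/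
theorem X11RankZero.bsdp_of_transfer_multiplicative_nonsplit
    (hEPW : cor514_transfer_of_multiplicative)
    (hJ : thm61_nonsplitMultiplicative) (hH : exists_isMultCanonical)
    (hGZK : rank_eq_analyticRank_of_analyticRank_le_one) (hmod : hasEntireLFunction_rat)
    (W₁ : WeierstrassCurve ℚ) [W₁.IsElliptic] [W₁.IsGloballyMinimal]
    {κ : ZpExtension ℚ p} {γ : Field.absoluteGaloisGroup ℚ} {N : ℕ} [NeZero N]
    {f : CuspForm (Gamma0 N) 2} (hp : 5 ≤ p) (hr : W.analyticRank = 0) (hX : ClassX11 W p)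
    (hns : ¬ W.HasSplitMultiplicativeReductionAtPrime p)
    (hmult₁ : W₁.HasMultiplicativeReductionAtPrime p)
    (hiso : ∃ e : geomTorsion W₁ (p : ℤ) ≃+ geomTorsion W (p : ℤ),
      ∀ (σ : Field.absoluteGaloisGroup ℚ) (P : geomTorsion W₁ (p : ℤ)), e (σ • P) = σ • e P)
    (hirr₁ : W₁.HasIrreducibleModPGaloisRep p) (h₁ : MultiplicativeCharIdealMuZero W₁ p)
    {q : ℚ_[p]} (hq0 : q ≠ 0) (hq1 : ‖q‖ < 1) (hqj : tateJ q = (W.j : ℚ_[p]))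
    (hκ : κ.IsCyclotomic) (hγ : κ.IsTopGenerator γ) (hγ' : IsCyclotomicVariable p γ)
    (hf : IsNewformOf W f) (D : W.SelmerDualData κ γ) (ϖ : ℚ) (hϖ0 : ϖ ≠ 0)
    (hϖ : (ϖ : ℝ) * W.realPeriodRat = plusPeriod f)
    (L : PowerSeries ℚ_[p]) (hL : IsMultPAdicLFunctionOf f p (-1) L) : BSDp W p :=
  X11RankZero.bsdp_of_multCharIdealMuZero_nonsplit W p hJ hH hGZK hmod (by omega) hr hX hns
    (hEPW W₁ W p hp hmult₁ hX.mult hiso hirr₁ h₁) hq0 hq1 hqj hκ hγ hγ' hf D ϖ hϖ0 hϖ L hL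

/-- **X11 ∧ `r = 0`, split `p ≥ 5`, MULTIPLICATIVE partner**: as above, through
`X11RankZero.bsdp_of_multCharIdealMuZero_split`. [cite: EmertonPollackWeston2006, Cor. 5.1.4 and Thm. 5.1.3 (arXiv p. 30)]
[cite: SteinWuthrich2013, Thm. 6.1 (p. 20)] [cite: GreenbergStevens1993, Thm. (trivial zero)] -/
theorem X11RankZero.bsdp_of_transfer_multiplicative_split (hEPW : cor514_transfer_of_multiplicative)
    (hJ : thm61_splitMultiplicative) (hH : exists_isSplitMultCanonical)
    (hGZK : rank_eq_analyticRank_of_analyticRank_le_one) (hmod : hasEntireLFunction_rat)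
    (hGS : greenberg_stevens (W := W) (p := p)) (h𝓛 : LInvariant_ne_zero (W := W) (p := p))
    (W₁ : WeierstrassCurve ℚ) [W₁.IsElliptic] [W₁.IsGloballyMinimal]
    {κ : ZpExtension ℚ p} {γ : Field.absoluteGaloisGroup ℚ} {N : ℕ} [NeZero N]
    {f : CuspForm (Gamma0 N) 2} (hp : 5 ≤ p) (hr : W.analyticRank = 0) (hX : ClassX11 W p)
    (hmult₁ : W₁.HasMultiplicativeReductionAtPrime p)
    (hiso : ∃ e : geomTorsion W₁ (p : ℤ) ≃+ geomTorsion W (p : ℤ),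
      ∀ (σ : Field.absoluteGaloisGroup ℚ) (P : geomTorsion W₁ (p : ℤ)), e (σ • P) = σ • e P)
    (hirr₁ : W₁.HasIrreducibleModPGaloisRep p) (h₁ : MultiplicativeCharIdealMuZero W₁ p)
    (Dq : TateParameterData W p)
    (hκ : κ.IsCyclotomic) (hγ : κ.IsTopGenerator γ) (hγ' : IsCyclotomicVariable p γ)
    (hf : IsNewformOf W f) (D : W.SelmerDualData κ γ) (ϖ : ℚ) (hϖ0 : ϖ ≠ 0)
    (hϖ : (ϖ : ℝ) * W.realPeriodRat = plusPeriod f)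
    (L : PowerSeries ℚ_[p]) (hL : IsSplitMultPAdicLFunctionOf f p L) : BSDp W p :=
  X11RankZero.bsdp_of_multCharIdealMuZero_split W p hJ hH hGZK hmod hGS h𝓛 (by omega) hr hX
    (hEPW W₁ W p hp hmult₁ Dq.split.hasMultiplicativeReductionAtPrime hiso hirr₁ h₁) Dq hκ hγ hγ' hf D
    ϖ hϖ0 hϖ L hL

end Literature.NumberTheory.EllipticCurves.Rank1Residual.Typed
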